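import Summits.CriticalPhenomena.Ising3DConformalLimit.Theorems.ReflectionTwinTwinThresholdSeamMonotone
import Summits.CriticalPhenomena.Ising3DConformalLimit.Theorems.ReflectionTwinTwinThresholdStrongSeamOrder
import Summits.CriticalPhenomena.Ising3DConformalLimit.Theorems.ReflectionTwinTwinThresholdPlaneSummableOfSurfaceSummable
import Summits.CriticalPhenomena.Ising3DConformalLimit.Theorems.ReflectionTwinTwinThresholdNoOrderAtOnsetOfBubbleIntegrable
import HarnessLib

/-!
# Crux `TwinThreshold` (stmt-CriticalPhenomena-16906), line `seam_renewal` — the kernel-checked REDUCTION of the crux to (W1) ∧ (C2)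

Line lead `prover-line-stmt-CriticalPhenomena-16906-0`, cycle 1. The checked skeleton `Cruxes/TwinThreshold/Lines/seam_renewal.lean`
composes six registered stubs into the route decl `ReflectionTwin.TwinThreshold`; four of them are LANDED theorems (imported above):

* (M) `stub_seamMonotone` — Griffiths monotonicity of the plane two-point function in the seam coupling (p166260);
* (S) `stub_strongSeamOrder` — plane long-range order at strong seam coupling, `J* < ∞` (p168573, helpers p168423/p168424);
* (W2) `stub_planeSummable_of_surfaceSummable` — Lieb–Simon renewal across the seam: finite surface susceptibility of the critical
  (111) half-crystal ⇒ bounded plane sums of the weakly sewn twin (p169014, helpers p168704/p168794/p168894);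
* (C′) `stub_noOrderAtOnset_of_bubbleIntegrable` — Lebowitz transport in `J`: an integrable sub-threshold thick-plane bubble ⇒ no
  plane order AT the onset (p167917, Literature helper `PairIsingAffineTransport` p167722).

This file records, as ONE sorry-free theorem of the tree, what the line has reduced the crux to: the two OPEN registered stubs
(W1) `stub_surfaceSummable` (finite surface susceptibility of the critical (111) half-crystal with free surface — the ordinary
surface transition has `Δ̂_ord > 1`, i.e. `γ₁₁ < 0`; physics margin `Δ̂_ord − 1 ≈ 0.28`, no rigorous engine) and (C2)
`stub_bubbleIntegrable` (an integrable majorant of the thick-plane bubble on the disordered ray — open-side rate condition; physics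
margin `η > 0` at a transparent onset). Statement: `(W1) → (C2) → TwinThreshold`, the antecedents being the registered signatures
VERBATIM. Proof = the skeleton's glue: (W2)(W1) gives `J₀ > 0` with bounded plane partial sums, hence no plane order at `J₀`
(`not_planeOrder_of_summable`: the plane contains the injective family `n ↦ (n,-n,0)`); (C′)(C2) gives continuity at every onset;
(M) makes the order set an up-set; (S) makes it non-empty; the infimum argument (`exists_posThreshold_of`) finishes.
No new definition; the finite-volume objects are the tree's `PlaneSummable.twinLat` / `PlaneSummable.halfLat`
(`Theorems/ReflectionTwinTwinThresholdPlaneSummableRenewalLemmas.lean`), which unfold definitionally to the route's `let`s.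
-/

noncomputable section

namespace Summit.CriticalPhenomena.Ising3DConformalLimit.Cruxes.TwinThreshold.SeamRenewal

open scoped BigOperators Classical
open Set
open Literature.Probability.LatticeModels

/-- **Bounded partial sums along the plane exclude plane long-range order**: the plane `{c | c₀+c₁+c₂ = 0}` contains the injective
family `n ↦ (n, -n, 0)`, so a uniform lower bound `m > 0` on `N` of its sites forces a partial sum `≥ N·m`, unbounded. [folklore] -/
theorem not_planeOrder_of_summable {G : Site 3 → ℝ} {C' : ℝ}
    (hsum : ∀ F : Finset (Site 3), (∀ c ∈ F, c 0 + c 1 + c 2 = 0) → ∑ c ∈ F, G c ≤ C') :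
    ¬ ∃ m : ℝ, 0 < m ∧ ∀ c : Site 3, c 0 + c 1 + c 2 = 0 → m ≤ G c := by
  rintro ⟨m, hm, hle⟩
  obtain ⟨N, hN⟩ := exists_nat_gt (C' / m)
  let f : ℕ → Site 3 := fun n => ![(n : ℤ), -(n : ℤ), 0]
  have hf0 : ∀ n, f n 0 = n := fun n => by simp [f]
  have hf : Function.Injective f := by
    intro a b h
    have h0 : (a : ℤ) = b := by rw [← hf0 a, ← hf0 b, h]
    exact_mod_cast h0
  have hplane : ∀ n, f n 0 + f n 1 + f n 2 = 0 := fun n => by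
    simp [f, Matrix.cons_val_one]
  have h1 := hsum ((Finset.range N).image f) (by
    intro c hc
    obtain ⟨n, -, rfl⟩ := Finset.mem_image.1 hc
    exact hplane n)
  rw [Finset.sum_image fun a _ b _ h => hf h] at h1
  have h2 : (Finset.range N).card • m ≤ ∑ n ∈ Finset.range N, G (f n) :=
    Finset.card_nsmul_le_sum _ _ _ fun n _ => hle _ (hplane n)
  rw [Finset.card_range, nsmul_eq_mul] at h2
  have h3 : (N : ℝ) * m ≤ C' := h2.trans h1
  have h4 : (N : ℝ) ≤ C' / m := by rwa [le_div_iff₀ hm]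
  linarith

/-- **Threshold lemma.** For a predicate `P` on `ℝ` that is an up-set on `[0,∞)`, holds at some `J ≥ 0`, fails at some `J > 0`,
and never switches on AT a positive point approached through a `P`-free ray, `J* := sInf {J ≥ 0 | P J}` is a strictly positive
continuous threshold: `0 < J*`, `¬ P J*`, `P J'` for all `J' > J*`. [folklore] -/
theorem exists_posThreshold_of {P : ℝ → Prop}
    (hmono : ∀ J J' : ℝ, 0 ≤ J → J ≤ J' → P J → P J')
    (hex : ∃ J : ℝ, 0 ≤ J ∧ P J)
    (hdis : ∃ J : ℝ, 0 < J ∧ ¬ P J)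
    (honset : ∀ J : ℝ, 0 < J → (∀ J' : ℝ, 0 ≤ J' → J' < J → ¬ P J') → ¬ P J) :
    ∃ J : ℝ, 0 < J ∧ ¬ P J ∧ ∀ J' : ℝ, J < J' → P J' := by
  have hTne : ({J : ℝ | 0 ≤ J ∧ P J}).Nonempty := by
    obtain ⟨J, hJ0, hJ⟩ := hex
    exact ⟨J, hJ0, hJ⟩
  have hTbdd : BddBelow {J : ℝ | 0 ≤ J ∧ P J} := ⟨0, fun J hJ => hJ.1⟩
  have habove : ∀ J' : ℝ, sInf {J : ℝ | 0 ≤ J ∧ P J} < J' → P J' := by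
    intro J' hJ'
    obtain ⟨J, hJT, hJlt⟩ := exists_lt_of_csInf_lt hTne hJ'
    exact hmono J J' hJT.1 hJlt.le hJT.2
  obtain ⟨J₀, hJ₀pos, hJ₀dis⟩ := hdis
  have hJ₀le : J₀ ≤ sInf {J : ℝ | 0 ≤ J ∧ P J} := by
    by_contra h
    exact hJ₀dis (habove J₀ (not_le.mp h))
  have hpos : 0 < sInf {J : ℝ | 0 ≤ J ∧ P J} := hJ₀pos.trans_le hJ₀le
  have hnot : ¬ P (sInf {J : ℝ | 0 ≤ J ∧ P J}) := by
    refine honset _ hpos fun J' hJ'0 hJ'lt hPJ' => ?_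
    have hle : sInf {J : ℝ | 0 ≤ J ∧ P J} ≤ J' := csInf_le hTbdd ⟨hJ'0, hPJ'⟩
    exact absurd hle (not_le.mpr hJ'lt)
  exact ⟨_, hpos, hnot, habove⟩

/-- **REDUCTION OF THE CRUX TO ITS TWO OPEN STUBS (registered sub-goal `stub_twinThreshold_of_surfaceSummable_of_bubbleIntegrable`).**
`(W1) stub_surfaceSummable → (C2) stub_bubbleIntegrable → ReflectionTwin.TwinThreshold`, the two antecedents being the registered
signatures verbatim (beta-redex spelling over closed terms). Proof: the landed (M), (S), (W2), (C′) and the infimum argument, all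
brought to the common normal form over `PlaneSummable.twinLat` / `PlaneSummable.halfLat` by `change` (definitional unfolding only).
[folklore] -/
theorem stub_twinThreshold_of_surfaceSummable_of_bubbleIntegrable : open Literature.Probability.LatticeModels in (((fun (hZ : Site 3 → ℤ) => (fun (halfLat : (k : ℕ) → (Fin k → Site 3) → ℝ) => ∃ C : ℝ, ∀ v : Site 3, hZ v = -1 → ∀ F : Finset (Site 3), (∀ u ∈ F, hZ u = -1) → ∑ u ∈ F, halfLat 2 ![v, u] ≤ C) (fun (k : ℕ) (z : Fin k → Site 3) => ⨆ L : ℕ, PairIsing.gibbsAvg (fun a b : ↥((box 3 L).filter (fun x : Site 3 => x 0 + x 1 + x 2 ≤ -1)) => if (∑ i, |a.1 i - b.1 i| = 1) then criticalBeta 3 / 2 else (0 : ℝ)) (fun s => ∏ i, if h : z i ∈ ((box 3 L).filter (fun x : Site 3 => x 0 + x 1 + x 2 ≤ -1)) then spinAt (⟨z i, h⟩ : ↥((box 3 L).filter (fun x : Site 3 => x 0 + x 1 + x 2 ≤ -1))) s else 0))) (fun z : Site 3 => z 0 + z 1 + z 2)) → ((fun (hZ : Site 3 → ℤ) => (fun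 (twinLat : ℝ → (k : ℕ) → (Fin k → Site 3) → ℝ) => (fun (boxPair : ℝ → (L : ℕ) → ↥(box 3 L) → ↥(box 3 L) → ℝ) => (fun (LRO : ℝ → Prop) => ∃ Bf : ℝ → ℝ, (∀ J₁ : ℝ, IntervalIntegrable Bf MeasureTheory.volume 0 J₁) ∧ ∀ J J'' : ℝ, 0 ≤ J → J < J'' → ¬ LRO J'' → ∀ (L : ℕ) (x : ↥(box 3 L)), hZ x.1 = 0 → (∑ u : ↥(box 3 L), if (hZ u.1 = -1 ∨ hZ u.1 = 0 ∨ hZ u.1 = 1) then boxPair J L x u ^ 2 else 0) ≤ Bf J) (fun J : ℝ => ∃ m : ℝ, 0 < m ∧ ∀ c : Site 3, hZ c = 0 → m ≤ twinLat J 2 ![0, c])) (fun (J : ℝ) (L : ℕ) (x u : ↥(box 3 L)) => PairIsing.gibbsAvg (fun a b : ↥(box 3 L) => if (((∑ i, |a.1 i - b.1 i| = 1) ∧ ¬ ((a.1 0 + a.1 1 + a.1 2 = 0 ∧ b.1 0 + b.1 1 + b.1 2 = 1) ∨ (a.1 0 + a.1 1 + a.1 2 = 1 ∧ b.1 0 +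 b.1 1 + b.1 2 = 0))) ∨ (((a.1 0 + a.1 1 + a.1 2 = 0 ∧ b.1 0 + b.1 1 + b.1 2 = 1) ∨ (a.1 0 + a.1 1 + a.1 2 = 1 ∧ b.1 0 + b.1 1 + b.1 2 = 0)) ∧ ∃ i : Fin 3, a.1 + b.1 = Pi.single i 1)) then (criticalBeta 3 / 2) * (if a.1 0 + a.1 1 + a.1 2 = 0 ∨ b.1 0 + b.1 1 + b.1 2 = 0 then J else 1) else 0) (fun s => spinAt x s * spinAt u s))) (fun (J : ℝ) (k : ℕ) (z : Fin k → Site 3) => ⨆ L : ℕ, PairIsing.gibbsAvg (fun a b : ↥(box 3 L) => if (((∑ i, |a.1 i - b.1 i| = 1) ∧ ¬ ((a.1 0 + a.1 1 + a.1 2 = 0 ∧ b.1 0 + b.1 1 + b.1 2 = 1) ∨ (a.1 0 + a.1 1 + a.1 2 = 1 ∧ b.1 0 + b.1 1 + b.1 2 = 0))) ∨ (((a.1 0 + a.1 1 + a.1 2 = 0 ∧ b.1 0 + b.1 1 + b.1 2 = 1) ∨ (a.1 0 + a.1 1 + a.1 2 = 1 ∧ b.1 0 + b.1 1 + b.1 2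 = 0)) ∧ ∃ i : Fin 3, a.1 + b.1 = Pi.single i 1)) then (criticalBeta 3 / 2) * (if a.1 0 + a.1 1 + a.1 2 = 0 ∨ b.1 0 + b.1 1 + b.1 2 = 0 then J else 1) else 0) (fun s => ∏ i, if h : z i ∈ box 3 L then spinAt (⟨z i, h⟩ : ↥(box 3 L)) s else 0))) (fun z : Site 3 => z 0 + z 1 + z 2)) → Summit.CriticalPhenomena.Ising3DConformalLimit.Theses.ReflectionTwin.TwinThreshold) := by
  intro hW1 hC2
  have hM := stub_seamMonotone
  have hS := stub_strongSeamOrder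
  have hW2 := stub_planeSummable_of_surfaceSummable
  have hC' := stub_noOrderAtOnset_of_bubbleIntegrable
  change ∀ J J' : ℝ, 0 ≤ J → J ≤ J' → ∀ c : Site 3, PlaneSummable.twinLat J 2 ![0, c] ≤ PlaneSummable.twinLat J' 2 ![0, c] at hM
  change ∃ J : ℝ, 0 ≤ J ∧ ∃ m : ℝ, 0 < m ∧ ∀ c : Site 3, c 0 + c 1 + c 2 = 0 → m ≤ PlaneSummable.twinLat J 2 ![0, c] at hS
  change (∃ C : ℝ, ∀ v : Site 3, v 0 + v 1 + v 2 = -1 → ∀ F : Finset (Site 3), (∀ u ∈ F, u 0 + u 1 + u 2 = -1) →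
      ∑ u ∈ F, PlaneSummable.halfLat 2 ![v, u] ≤ C) at hW1
  change (∃ C : ℝ, ∀ v : Site 3, v 0 + v 1 + v 2 = -1 → ∀ F : Finset (Site 3), (∀ u ∈ F, u 0 + u 1 + u 2 = -1) →
      ∑ u ∈ F, PlaneSummable.halfLat 2 ![v, u] ≤ C) → ∃ J₀ : ℝ, 0 < J₀ ∧ ∀ J : ℝ, 0 < J → J ≤ J₀ → ∃ C' : ℝ,
      ∀ F : Finset (Site 3), (∀ c ∈ F, c 0 + c 1 + c 2 = 0) → ∑ c ∈ F, PlaneSummable.twinLat J 2 ![0, c] ≤ C' at hW2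
  have hC : ∀ J : ℝ, 0 < J → (∀ J' : ℝ, 0 ≤ J' → J' < J →
      ¬ ∃ m : ℝ, 0 < m ∧ ∀ c : Site 3, c 0 + c 1 + c 2 = 0 → m ≤ PlaneSummable.twinLat J' 2 ![0, c]) →
      ¬ ∃ m : ℝ, 0 < m ∧ ∀ c : Site 3, c 0 + c 1 + c 2 = 0 → m ≤ PlaneSummable.twinLat J 2 ![0, c] := hC' hC2
  change ∃ J : ℝ, 0 < J ∧ (¬ ∃ m : ℝ, 0 < m ∧ ∀ c : Site 3, c 0 + c 1 + c 2 = 0 → m ≤ PlaneSummable.twinLat J 2 ![0, c]) ∧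
      ∀ J' : ℝ, J < J' → ∃ m : ℝ, 0 < m ∧ ∀ c : Site 3, c 0 + c 1 + c 2 = 0 → m ≤ PlaneSummable.twinLat J' 2 ![0, c]
  have hW : ∃ J : ℝ, 0 < J ∧ ¬ ∃ m : ℝ, 0 < m ∧ ∀ c : Site 3, c 0 + c 1 + c 2 = 0 → m ≤ PlaneSummable.twinLat J 2 ![0, c] := by
    obtain ⟨J₀, hJ₀, hall⟩ := hW2 hW1
    obtain ⟨C', hsum⟩ := hall J₀ hJ₀ le_rfl
    exact ⟨J₀, hJ₀, not_planeOrder_of_summable hsum⟩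
  refine exists_posThreshold_of
    (P := fun J => ∃ m : ℝ, 0 < m ∧ ∀ c : Site 3, c 0 + c 1 + c 2 = 0 → m ≤ PlaneSummable.twinLat J 2 ![0, c]) ?_ hS hW hC
  rintro J J' hJ hJJ' ⟨m, hm, hle⟩
  exact ⟨m, hm, fun c hc => (hle c hc).trans (hM J J' hJ hJJ' c)⟩

end Summit.CriticalPhenomena.Ising3DConformalLimit.Cruxes.TwinThreshold.SeamRenewal

end
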